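import Mathlib.Analysis.InnerProductSpace.Spectrum
import Mathlib.Analysis.Matrix.Spectrum
import HarnessLib

/-!
# Weinstein's a-posteriori eigenvalue inclusion for symmetric operators
# (a quasimode at level `η` forces an eigenvalue in `[μ − η, μ + η]`)

Topic `Literature/Analysis/InnerProduct` (next to `CourantFischerBounds`). For a symmetric operator
`T` on a finite-dimensional inner product space `E` over `𝕜 = ℝ` or `ℂ`, with Mathlib's
enumeration `λ = hT.eigenvalues hn : Fin n → ℝ` and orthonormal eigenvector basis
`b = hT.eigenvectorBasis hn`:

* `inner_eigenvectorBasis_apply_sub_smul` — `⟪bᵢ, T x − μ x⟫ = (λᵢ − μ) ⟪bᵢ, x⟫`;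
* `norm_sq_sub_smul_apply_eq_sum` — Parseval for the residual:
  `‖T x − μ x‖² = Σᵢ (λᵢ − μ)² ‖⟪bᵢ, x⟫‖²`;
* **Weinstein's inequality** `exists_abs_eigenvalues_sub_mul_norm_le` — for `x ≠ 0` and real `μ`
  some eigenvalue satisfies `|λᵢ − μ| ‖x‖ ≤ ‖T x − μ x‖`, i.e. the interval
  `[μ − ‖r‖/‖x‖, μ + ‖r‖/‖x‖]` around an approximate eigenvalue `μ` with residual `r = T x − μ x`
  contains an eigenvalue (Horn–Johnson, *Matrix Analysis*, 2nd ed., Thm. 6.3.14 (b), (6.3.16), the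
  normal case; D. H. Weinstein 1934; the Krylov–Weinstein / Bauer–Fike bound with condition number
  one);
* the QUASIMODE DICTIONARY `exists_abs_eigenvalues_le_of_norm_apply_le` — `‖T x‖ ≤ η ‖x‖` with
  `x ≠ 0` gives an eigenvalue in `[−η, η]` (the case `μ = 0`);
* the bridge `isHermitian_eigenvalues_equivOfCardEq` / `exists_isHermitian_eigenvalues_iff` between
  Mathlib's `Matrix.IsHermitian.eigenvalues : m → ℝ` and the `Fin (card m)`-indexed eigenvalues of
  the symmetric operator `Matrix.toEuclideanLin A`, and through it
* the Hermitian-MATRIX form in coordinates `exists_abs_eigenvalues_le_of_sum_norm_sq_mulVec_le` —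
  `Σᵢ ‖(A x)ᵢ‖² ≤ η² Σᵢ ‖xᵢ‖²`, `x ≠ 0`, `0 ≤ η` gives `∃ i, |hA.eigenvalues i| ≤ η` for
  Mathlib's `Matrix.IsHermitian.eigenvalues` (through `Matrix.toEuclideanLin` and the definitional
  bridge `hA.eigenvalues (e j) = (toEuclideanLin A).eigenvalues j`).

Everything is proved from Mathlib's spectral theorem (`LinearMap.IsSymmetric.eigenvectorBasis`,
`apply_eigenvectorBasis`) and Parseval (`OrthonormalBasis.sum_sq_norm_inner_right`). No
definitions, no named facts. Mathlib (searched `Weinstein`, `exists_abs_eigenvalues_sub`,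
`eigenvalues.*norm_sub`, `dist.*eigenvalues`, `Bauer`) has no a-posteriori eigenvalue bound; the
tree has the `EuclideanSpace`/Hermitian-matrix special case with residual `toEuclideanLin H x − μ x`
(`Literature.LinearAlgebra.Matrix.exists_abs_eigenvalues_sub_mul_norm_le`,
`HermitianEigenvaluePerturbation.lean`), of which the operator form here is the basis-free
generalisation and the `mulVec` form the coordinate repackaging.

## References

* R. A. Horn, C. R. Johnson, *Matrix Analysis*, 2nd ed., CUP (2013), Thm. 6.3.14 (b), eq. (6.3.16)
  (a-posteriori residual bound for normal matrices). [HornJohnson2013]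
* D. H. Weinstein, *Modified Ritz method*, Proc. Natl. Acad. Sci. USA 20 (1934) 529–532.
* B. N. Parlett, *The Symmetric Eigenvalue Problem*, SIAM Classics in Applied Mathematics 20 (1998),
  Thm. 4.5.1.
-/

noncomputable section

open scoped InnerProductSpace ComplexConjugate
open Module Finset

namespace Literature.Analysis.InnerProduct

variable {𝕜 : Type*} [RCLike 𝕜] {E : Type*} [NormedAddCommGroup E] [InnerProductSpace 𝕜 E]
  [FiniteDimensional 𝕜 E] {T : E →ₗ[𝕜] E} {n : ℕ}

/-! ### The residual in eigen-coordinates -/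

/-- Coefficients of the residual `T x − μ x` in the orthonormal eigenvector basis of a symmetric
`T`: `⟪bᵢ, T x − μ x⟫ = (λᵢ − μ) ⟪bᵢ, x⟫` (symmetry moves `T` onto `bᵢ`, `T bᵢ = λᵢ bᵢ`, `λᵢ`
real). [folklore] -/
theorem inner_eigenvectorBasis_apply_sub_smul (hT : T.IsSymmetric) (hn : finrank 𝕜 E = n)
    (x : E) (μ : ℝ) (i : Fin n) :
    ⟪hT.eigenvectorBasis hn i, T x - (μ : 𝕜) • x⟫_𝕜 =
      ((hT.eigenvalues hn i - μ : ℝ) : 𝕜) * ⟪hT.eigenvectorBasis hn i, x⟫_𝕜 := by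
  rw [inner_sub_right, ← hT (hT.eigenvectorBasis hn i) x, hT.apply_eigenvectorBasis,
    inner_smul_left, inner_smul_right, RCLike.conj_ofReal]
  push_cast
  ring

/-- **Parseval for the residual.** `‖T x − μ x‖² = Σᵢ (λᵢ − μ)² ‖⟪bᵢ, x⟫‖²` in the orthonormal
eigenvector basis of a symmetric `T`, for every real shift `μ`. [folklore] -/
theorem norm_sq_sub_smul_apply_eq_sum (hT : T.IsSymmetric) (hn : finrank 𝕜 E = n) (x : E)
    (μ : ℝ) :
    ‖T x - (μ : 𝕜) • x‖ ^ 2 =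
      ∑ i : Fin n, (hT.eigenvalues hn i - μ) ^ 2 * ‖⟪(hT.eigenvectorBasis hn i : E), x⟫_𝕜‖ ^ 2 := by
  rw [← (hT.eigenvectorBasis hn).sum_sq_norm_inner_right (T x - (μ : 𝕜) • x)]
  refine Finset.sum_congr rfl fun i _ => ?_
  rw [inner_eigenvectorBasis_apply_sub_smul hT hn x μ i, norm_mul, mul_pow, RCLike.norm_ofReal,
    sq_abs]

/-! ### Weinstein's inequality -/

/-- **Weinstein's inequality (a-posteriori eigenvalue inclusion).** For a symmetric operator `T`
on a finite-dimensional inner product space, a non-zero vector `x` and a real trial value `μ`,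
some eigenvalue `λᵢ` of `T` satisfies `|λᵢ − μ| ‖x‖ ≤ ‖T x − μ x‖`: the interval of half-width
`‖T x − μ x‖ / ‖x‖` around `μ` contains an eigenvalue (Horn–Johnson (6.3.16), the normal case of
Thm. 6.3.14, specialised to Hermitian/symmetric; proof: pick `i` minimising `|λᵢ − μ|` and compare
`(min)² Σ ‖⟪bᵢ,x⟫‖² ≤ Σ (λᵢ − μ)² ‖⟪bᵢ,x⟫‖²` with Parseval). [cite: HornJohnson2013, Thm 6.3.14] -/
theorem exists_abs_eigenvalues_sub_mul_norm_le (hT : T.IsSymmetric) (hn : finrank 𝕜 E = n)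
    {x : E} (hx : x ≠ 0) (μ : ℝ) :
    ∃ i : Fin n, |hT.eigenvalues hn i - μ| * ‖x‖ ≤ ‖T x - (μ : 𝕜) • x‖ := by
  have hn0 : 0 < n := hn ▸ Module.finrank_pos_iff_exists_ne_zero.2 ⟨x, hx⟩
  haveI : Nonempty (Fin n) := ⟨⟨0, hn0⟩⟩
  obtain ⟨i₀, -, hi₀⟩ := Finset.exists_min_image Finset.univ
    (fun i => |hT.eigenvalues hn i - μ|) Finset.univ_nonempty
  refine ⟨i₀, ?_⟩
  have hsq : (|hT.eigenvalues hn i₀ - μ| * ‖x‖) ^ 2 ≤ ‖T x - (μ : 𝕜) • x‖ ^ 2 := by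
    rw [mul_pow, ← (hT.eigenvectorBasis hn).sum_sq_norm_inner_right x, Finset.mul_sum,
      norm_sq_sub_smul_apply_eq_sum hT hn x μ]
    refine Finset.sum_le_sum fun i _ => ?_
    refine mul_le_mul_of_nonneg_right ?_ (sq_nonneg _)
    rw [← sq_abs (hT.eigenvalues hn i - μ)]
    exact pow_le_pow_left₀ (abs_nonneg _) (hi₀ i (Finset.mem_univ i)) 2
  exact (pow_le_pow_iff_left₀ (mul_nonneg (abs_nonneg _) (norm_nonneg _)) (norm_nonneg _)
    two_ne_zero).1 hsq

/-- **Weinstein's inequality, distance form.** For `x ≠ 0` some eigenvalue lies within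
`‖T x − μ x‖ / ‖x‖` of the trial value `μ`. [cite: HornJohnson2013, Thm 6.3.14] -/
theorem exists_abs_eigenvalues_sub_le_div (hT : T.IsSymmetric) (hn : finrank 𝕜 E = n)
    {x : E} (hx : x ≠ 0) (μ : ℝ) :
    ∃ i : Fin n, |hT.eigenvalues hn i - μ| ≤ ‖T x - (μ : 𝕜) • x‖ / ‖x‖ := by
  obtain ⟨i, hi⟩ := exists_abs_eigenvalues_sub_mul_norm_le hT hn hx μ
  exact ⟨i, (le_div_iff₀ (norm_pos_iff.2 hx)).2 hi⟩

/-! ### The quasimode dictionary (`μ = 0`) -/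

/-- **Quasimode ⇒ nearby eigenvalue.** If a non-zero `x` is a quasimode of the symmetric operator
`T` at level `η`, `‖T x‖ ≤ η ‖x‖`, then `T` has an eigenvalue in `[−η, η]` (Weinstein's
inequality at `μ = 0`). [cite: HornJohnson2013, Thm 6.3.14] -/
theorem exists_abs_eigenvalues_le_of_norm_apply_le (hT : T.IsSymmetric) (hn : finrank 𝕜 E = n)
    {x : E} (hx : x ≠ 0) {η : ℝ} (h : ‖T x‖ ≤ η * ‖x‖) :
    ∃ i : Fin n, |hT.eigenvalues hn i| ≤ η := by
  obtain ⟨i, hi⟩ := exists_abs_eigenvalues_sub_mul_norm_le hT hn hx 0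
  refine ⟨i, ?_⟩
  rw [sub_zero, RCLike.ofReal_zero, zero_smul, sub_zero] at hi
  exact le_of_mul_le_mul_right (hi.trans h) (norm_pos_iff.2 hx)

/-- **Quasimode ⇒ nearby eigenvalue, squared form.** `‖T x‖² ≤ η² ‖x‖²` with `x ≠ 0`, `0 ≤ η`
gives an eigenvalue of the symmetric `T` in `[−η, η]`. [cite: HornJohnson2013, Thm 6.3.14] -/
theorem exists_abs_eigenvalues_le_of_norm_sq_apply_le (hT : T.IsSymmetric)
    (hn : finrank 𝕜 E = n) {x : E} (hx : x ≠ 0) {η : ℝ} (hη : 0 ≤ η)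
    (h : ‖T x‖ ^ 2 ≤ η ^ 2 * ‖x‖ ^ 2) :
    ∃ i : Fin n, |hT.eigenvalues hn i| ≤ η := by
  refine exists_abs_eigenvalues_le_of_norm_apply_le hT hn hx ?_
  rw [← mul_pow] at h
  exact (pow_le_pow_iff_left₀ (norm_nonneg _) (mul_nonneg hη (norm_nonneg _)) two_ne_zero).1 h

/-! ### Hermitian matrices in coordinates -/

section Matrix

open Matrix WithLp

variable {m : Type*} [Fintype m] [DecidableEq m]

/-- Bridge between Mathlib's two eigenvalue enumerations: the eigenvalues of a Hermitian matrix
`A`, `hA.eigenvalues : m → ℝ`, are the eigenvalues of the symmetric operator `toEuclideanLin A`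
re-indexed along `Fin (card m) ≃ m` (definitional, `Matrix.IsHermitian.eigenvalues₀`).
[folklore] -/
theorem isHermitian_eigenvalues_equivOfCardEq {A : Matrix m m 𝕜} (hA : A.IsHermitian)
    (j : Fin (Fintype.card m)) :
    hA.eigenvalues (Fintype.equivOfCardEq (Fintype.card_fin _) j) =
      (isSymmetric_toEuclideanLin_iff.mpr hA).eigenvalues finrank_euclideanSpace j := by
  simp only [Matrix.IsHermitian.eigenvalues, Matrix.IsHermitian.eigenvalues₀,
    Equiv.symm_apply_apply]

/-- Transfer of existential statements about eigenvalues between the two enumerations: some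
`hA.eigenvalues i` has property `P` iff some eigenvalue of the symmetric operator
`toEuclideanLin A` has it. [folklore] -/
theorem exists_isHermitian_eigenvalues_iff {A : Matrix m m 𝕜} (hA : A.IsHermitian)
    (P : ℝ → Prop) :
    (∃ i, P (hA.eigenvalues i)) ↔ ∃ j : Fin (Fintype.card m),
      P ((isSymmetric_toEuclideanLin_iff.mpr hA).eigenvalues finrank_euclideanSpace j) := by
  constructor
  · rintro ⟨i, hi⟩
    refine ⟨(Fintype.equivOfCardEq (Fintype.card_fin _)).symm i, ?_⟩
    rwa [← isHermitian_eigenvalues_equivOfCardEq hA, Equiv.apply_symm_apply]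
  · rintro ⟨j, hj⟩
    exact ⟨_, (isHermitian_eigenvalues_equivOfCardEq hA j).symm ▸ hj⟩

/-- **Quasimode ⇒ nearby eigenvalue, Hermitian matrices in coordinates.** If `A` is Hermitian,
`x ≠ 0` and `Σᵢ ‖(A x)ᵢ‖² ≤ η² Σᵢ ‖xᵢ‖²` with `0 ≤ η`, then `|hA.eigenvalues i| ≤ η` for some
index `i` (Weinstein's inequality at `μ = 0` for `toEuclideanLin A` on `EuclideanSpace 𝕜 m`).
[cite: HornJohnson2013, Thm 6.3.14] -/
theorem exists_abs_eigenvalues_le_of_sum_norm_sq_mulVec_le {A : Matrix m m 𝕜}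
    (hA : A.IsHermitian) {x : m → 𝕜} (hx : x ≠ 0) {η : ℝ} (hη : 0 ≤ η)
    (h : ∑ i, ‖(A *ᵥ x) i‖ ^ 2 ≤ η ^ 2 * ∑ i, ‖x i‖ ^ 2) :
    ∃ i, |hA.eigenvalues i| ≤ η := by
  have hS : (toEuclideanLin A).IsSymmetric := isSymmetric_toEuclideanLin_iff.mpr hA
  have hy : (toLp 2 x : EuclideanSpace 𝕜 m) ≠ 0 := fun h0 => hx ((toLp_eq_zero 2).1 h0)
  have h1 : ‖toEuclideanLin A (toLp 2 x)‖ ^ 2 = ∑ i, ‖(A *ᵥ x) i‖ ^ 2 :=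
    EuclideanSpace.norm_sq_eq _
  have h2 : ‖(toLp 2 x : EuclideanSpace 𝕜 m)‖ ^ 2 = ∑ i, ‖x i‖ ^ 2 :=
    EuclideanSpace.norm_sq_eq _
  exact (exists_isHermitian_eigenvalues_iff hA fun t => |t| ≤ η).2
    (exists_abs_eigenvalues_le_of_norm_sq_apply_le hS finrank_euclideanSpace hy hη
      (by rw [h1, h2]; exact h))

end Matrix

end Literature.Analysis.InnerProduct

end
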